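import Literature.Topology.FourManifolds.SlideSetup2
import Literature.Topology.FourManifolds.FingerBandUp
import HarnessLib

/-!
# The slide set-up, III: the fingertip data (controlled descent and the two fingertip halves)

Topic `Literature/Topology/FourManifolds`; fact seat `provefact-IsStrictHandleSlide.isSurgery`
(R. C. Kirby, *The Topology of 4-Manifolds*, LNM 1374 (1989), Ch. I §4, Fig. 4.2; remaining content:
the named fact (S) `Literature.Topology.FourManifolds.FramedLink.IsStrictHandleSlide.slideModel`).
From a `SlideChoice` (parts I–II): the `K1Loop2Data` of the finger knot (`BandCore.SlideChoice.loop2`: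
clamp radius `r_low = 1 + κ_D e₋/4`, blend width `β = κ_D e₋ / (4 s_max)`, gentle slope `λ`,
clamp margin `ε_f = κ_D e₋/8`, robust-descent zones of width `β + 2 Δh_c`,
`Δh_c = cmax κ_D e₊ / (q₋ mΘ)`), the axis height `h_A` (`ΘB h_A = φ`, by the intermediate value
/-- `between` (auxiliary). [folklore] -/
theorem between the two tips), and the two fingertip records `fingerLo : loop2.FingerAngleData`,
`fingerUp : FingerAngleDataUp fingerLo` — all their conditions being consequences of the fields of
the `SlideChoice` through `|tw| ≤ cmax`.

## References

* R. C. Kirby, *The Topology of 4-Manifolds*, LNM 1374, Springer (1989), Ch. I §4. [Kirby1989]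
-/

open scoped Topology ContDiff
open Set Real Filter

noncomputable section

namespace Literature.Topology.FourManifolds

namespace BandCore

variable {A B : Knot} {avoid : Set (Metric.sphere (0 : EuclideanSpace ℝ (Fin 4)) 1)} {c : BandCore A B avoid}

namespace SlideChoice

variable {e : ℝ → ℝ} (P : c.SlideChoice e) (he : ContDiffOn ℝ ∞ e (Ioo (10⁻¹ : ℝ) (9 / 10)))

/-! ### The fingertip constants -/

/-- The plunge bound `s_max = Mρ e₊ + Me`. [folklore] -/
def smaxc : ℝ := P.Mρ * P.emax + P.Me

/-- `smaxc_pos` (auxiliary). [folklore] -/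
theorem smaxc_pos : 0 < P.smaxc := by rw [smaxc]; nlinarith [P.Mρ_pos, P.emax_pos, P.Me_nonneg]

/-- The blend width `β = κ_D e₋ / (4 s_max)`. [folklore] -/
def βc : ℝ := P.κD * P.emin / (4 * P.smaxc)

/-- `βc_pos` (auxiliary). [folklore] -/
theorem βc_pos : 0 < P.βc := by rw [βc]; exact div_pos (mul_pos P.κD_pos P.emin_pos) (by linarith [P.smaxc_pos])

/-- `βc_le` (auxiliary). [folklore] -/
theorem βc_le : P.βc ≤ 100⁻¹ := P.β_small

/-- `smaxc_mul_βc` (auxiliary). [folklore] -/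
theorem smaxc_mul_βc : P.smaxc * P.βc = P.κD * P.emin / 4 := by
  rw [βc]; field_simp [P.smaxc_pos.ne']

/-- The zone extension `Δh_c = cmax κ_D e₊ / (q₋ mΘ)`. [folklore] -/
def Δhc : ℝ := c.cmax * P.κD * P.emax / (c.qminc * P.mΘ)

/-- `Δhc_nonneg` (auxiliary). [folklore] -/
theorem Δhc_nonneg : 0 ≤ P.Δhc :=
  div_nonneg (mul_nonneg (mul_nonneg c.cmax_nonneg P.κD_pos.le) P.emax_pos.le) (mul_pos c.qminc_pos P.mΘ_pos).le

/-- The robust-descent zone width `β + 2 Δh_c`. [folklore] -/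
def zone : ℝ := P.βc + 2 * P.Δhc

/-- `zone_pos` (auxiliary). [folklore] -/
theorem zone_pos : 0 < P.zone := by rw [zone]; linarith [P.βc_pos, P.Δhc_nonneg]

/-- `zone_eq` (auxiliary). [folklore] -/
theorem zone_eq : P.zone = P.κD * P.emin / (4 * (P.Mρ * P.emax + P.Me)) + 2 * c.cmax * P.κD * P.emax / (c.qminc * P.mΘ) := by
  rw [zone, βc, Δhc, smaxc]; ring

/-- `MΘ · zone ≤ θ_low / 2` (field `fingerA`). [folklore] -/
theorem MΘ_zone_le : P.MΘ * P.zone ≤ c.θlow / 2 := by rw [zone_eq]; exact P.fingerA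

/-- `λ · zone ≤ 3 κ_D e₋ / 8` (field `lam_clamp`). [folklore] -/
theorem lam_zone_le : P.lam * P.zone ≤ 3 * P.κD * P.emin / 8 := by
  have h := mul_le_mul_of_nonneg_left P.lam_clamp P.κD_pos.le
  rw [zone_eq]
  have e1 : P.κD * (P.lam * (P.emin / (4 * (P.Mρ * P.emax + P.Me)) + 2 * c.cmax * P.emax / (c.qminc * P.mΘ))) =
      P.lam * (P.κD * P.emin / (4 * (P.Mρ * P.emax + P.Me)) + 2 * c.cmax * P.κD * P.emax / (c.qminc * P.mΘ)) := by ring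
  rw [e1] at h; linarith

/-! ### The controlled-descent data of the finger knot -/

/-- `e_pos_win` (auxiliary). [folklore] -/
theorem e_pos_win (P : c.SlideChoice e) {h : ℝ} (hh : h ∈ Icc (0.12 : ℝ) 0.88) : 0 < e h :=
  lt_of_lt_of_le P.emin_pos (P.e_bounds h hh).1

/-- `hD_eq` (auxiliary). [folklore] -/
theorem hD_eq : P.dl.Hh P.dl.tD = P.hD := rfl
/-- `hDu_eq'` (auxiliary). [folklore] -/
theorem hDu_eq' : 1 - P.du.Hh P.du.tD = P.hDu := rfl

/-- `lam_le_lo` (auxiliary). [folklore] -/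
theorem lam_le_lo : P.lam + P.dl.κD * P.Me ≤ P.dl.vmin * P.emin / P.dl.MH := by
  have h1 := P.lam_leₗ; have h2 := P.κD_Meₗ; have hM := c.liteMH_pos
  rw [dl_vmin, dl_MH, dl_κD, le_div_iff₀ hM]; nlinarith

/-- `lam_le_up` (auxiliary). [folklore] -/
theorem lam_le_up : P.lam + P.du.κD * P.Me ≤ P.du.vmin * P.emin / P.du.MH := by
  have h1 := P.lam_leᵤ; have h2 := P.κD_Meᵤ; have hM := c.liteMHU_pos
  rw [du_vmin, du_MH, du_κD, le_div_iff₀ hM]; nlinarith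

/-- `dl_Mρ_of` (auxiliary). [folklore] -/
theorem dl_Mρ_of : P.dl.Mρ_of P.CT = c.Mρlo P.CT P.μ := rfl
/-- `du_Mρ_of` (auxiliary). [folklore] -/
theorem du_Mρ_of : P.du.Mρ_of P.CT = c.Mρup P.CT P.μ := rfl

/-- **The `K1Loop2Data` of the finger knot of the slide.** [cite: Kirby1989, Ch. I §4] -/
def loop2 : K1Loop2Data where
  dl := P.dl
  du := P.du
  e := e
  rlow := 1 + P.κD * P.emin / 4
  β := P.βc
  e_smooth := he
  e_pos := fun h hh ↦ e_pos_win P hh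
  rlow_gt := by have := mul_pos P.κD_pos P.emin_pos; linarith
  rlow_lt := fun h hh ↦ by
    have := (P.e_bounds h hh).1; have := P.κD_le_one; nlinarith [P.emin_pos]
  β_pos := P.βc_pos
  sep := by
    show P.dl.Hh P.dl.tD + P.βc < 1 - P.du.Hh P.du.tD - P.βc
    rw [hD_eq, hDu_eq']; have := P.hD_mem'.2; have := P.hDu_mem'.1; have := P.βc_le; linarith
  emin := P.emin
  emax := P.emax
  Me := P.Me
  Mρ := P.Mρ
  CT := P.CT
  lam := P.lam
  εf := P.κD * P.emin / 8
  hg := P.hD + P.zone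
  hgu := P.hDu - P.zone
  lo_win := by show (0.15 : ℝ) < P.dl.Hh P.dl.tD; rw [hD_eq]; linarith [P.hD_mem'.1]
  up_win := by show 1 - P.du.Hh P.du.tD < 0.85; rw [hDu_eq']; linarith [P.hDu_mem'.2]
  e_ge := fun h hh ↦ (P.e_bounds h hh).1
  e_le := fun h hh ↦ (P.e_bounds h hh).2
  emin_pos := P.emin_pos
  e_deriv := fun h hh ↦ P.e_deriv h ⟨by linarith [hh.1], by linarith [hh.2]⟩
  Mρ_pos := P.Mρ_pos
  ρt_deriv_le := fun h ↦ (P.dl.deriv_ρt_le P.CT_ge h).trans (P.dl_Mρ_of ▸ P.Mρ_geₗ)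
  ρt_deriv_le' := fun h ↦ (P.du.deriv_ρt_le P.CT_ge h).trans (P.du_Mρ_of ▸ P.Mρ_geᵤ)
  CT_ge := P.CT_ge
  CT_nonneg := P.CT_nonneg
  lam_pos := P.lam_pos
  εf_pos := by have := mul_pos P.κD_pos P.emin_pos; positivity
  β_le := by
    show P.βc ≤ P.dl.κD / (2 * P.Mρ)
    rw [dl_κD, βc, smaxc, div_le_div_iff₀ (by nlinarith [P.Mρ_pos, P.emax_pos, P.Me_nonneg]) (by linarith [P.Mρ_pos])]
    have h1 : 0 ≤ 2 * P.Mρ * (2 * P.emax - P.emin) + 4 * P.Me := by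
      nlinarith [P.Mρ_pos, P.emin_le_emax, P.Me_nonneg, P.emax_pos]
    nlinarith [mul_nonneg P.κD_pos.le h1]
  β_le' := by
    show P.βc ≤ P.du.κD / (2 * P.Mρ)
    rw [du_κD, βc, smaxc, div_le_div_iff₀ (by nlinarith [P.Mρ_pos, P.emax_pos, P.Me_nonneg]) (by linarith [P.Mρ_pos])]
    have h1 : 0 ≤ 2 * P.Mρ * (2 * P.emax - P.emin) + 4 * P.Me := by
      nlinarith [P.Mρ_pos, P.emin_le_emax, P.Me_nonneg, P.emax_pos]
    nlinarith [mul_nonneg P.κD_pos.le h1]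
  lam_le := P.lam_le_lo
  lam_le' := P.lam_le_up
  κD_e := P.κD_e
  κD_e' := P.κD_e
  hg_ge := by show P.dl.Hh P.dl.tD + P.βc ≤ P.hD + P.zone; rw [hD_eq, zone]; linarith [P.Δhc_nonneg]
  hgu_le := by show P.hDu - P.zone ≤ 1 - P.du.Hh P.du.tD - P.βc; rw [hDu_eq', zone]; linarith [P.Δhc_nonneg]
  clamp_lo := by
    show 1 + P.κD * P.emin / 4 + P.κD * P.emin / 8 ≤
      1 + P.dl.κD * e (P.dl.Hh P.dl.tD) - (P.Mρ * P.emax + P.Me) * P.βc - P.lam * (P.hD + P.zone - P.dl.Hh P.dl.tD)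
    rw [hD_eq, dl_κD]
    have h1 : (P.Mρ * P.emax + P.Me) * P.βc = P.κD * P.emin / 4 := P.smaxc_mul_βc
    have h2 := P.lam_zone_le
    have h3 := (P.e_bounds _ P.hD_win).1
    nlinarith [P.κD_pos]
  clamp_up := by
    show 1 + P.κD * P.emin / 4 + P.κD * P.emin / 8 ≤
      1 + P.du.κD * e (1 - P.du.Hh P.du.tD) - (P.Mρ * P.emax + P.Me) * P.βc -
        P.lam * (1 - P.du.Hh P.du.tD - P.βc - (P.hDu - P.zone) + P.βc)
    rw [hDu_eq', du_κD]
    have h1 : (P.Mρ * P.emax + P.Me) * P.βc = P.κD * P.emin / 4 := P.smaxc_mul_βc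
    have h2 := P.lam_zone_le
    have h3 := (P.e_bounds _ P.hDu_win).1
    nlinarith [P.κD_pos]
  clamp_base := by show 1 + P.κD * P.emin / 4 + P.κD * P.emin / 8 ≤ 1 + P.dl.κD * P.emin; rw [dl_κD]; nlinarith [P.κD_pos, P.emin_pos]
  clamp_base' := by show 1 + P.κD * P.emin / 4 + P.κD * P.emin / 8 ≤ 1 + P.du.κD * P.emin; rw [du_κD]; nlinarith [P.κD_pos, P.emin_pos]
  meet := by
    show P.dl.Hh P.dl.tD + (1 + P.dl.κD * e (P.dl.Hh P.dl.tD) - (P.Mρ * P.emax + P.Me) * P.βc - (1 + P.κD * P.emin / 4)) / P.lam ≤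
      1 - P.du.Hh P.du.tD - (1 + P.du.κD * e (1 - P.du.Hh P.du.tD) - (P.Mρ * P.emax + P.Me) * P.βc - (1 + P.κD * P.emin / 4)) / P.lam
    rw [hD_eq, hDu_eq', dl_κD, du_κD]
    have h1 : (P.Mρ * P.emax + P.Me) * P.βc = P.κD * P.emin / 4 := P.smaxc_mul_βc
    have hl := P.lam_pos
    have hm := P.fingerMeet
    have e1 := (P.e_bounds _ P.hD_win).2; have e2 := (P.e_bounds _ P.hDu_win).2
    have hgap : (0.1 : ℝ) ≤ P.hDu - P.hD := by have := P.hD_mem'.2; have := P.hDu_mem'.1; linarith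
    have hb1 : (1 + P.κD * e P.hD - P.κD * P.emin / 4 - (1 + P.κD * P.emin / 4)) / P.lam ≤ P.κD * P.emax / P.lam :=
      div_le_div_of_nonneg_right (by nlinarith [P.κD_pos, P.emin_pos]) hl.le
    have hb2 : (1 + P.κD * e P.hDu - P.κD * P.emin / 4 - (1 + P.κD * P.emin / 4)) / P.lam ≤ P.κD * P.emax / P.lam :=
      div_le_div_of_nonneg_right (by nlinarith [P.κD_pos, P.emin_pos]) hl.le
    have hb3 : P.κD * P.emax / P.lam ≤ 0.05 := by rw [div_le_iff₀ hl]; linarith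
    rw [h1]; linarith

/-- `loop2_hD` (auxiliary). [folklore] -/
theorem loop2_hD : (P.loop2 he).hD = P.hD := rfl
/-- `loop2_hDu` (auxiliary). [folklore] -/
theorem loop2_hDu : (P.loop2 he).hDu = P.hDu := rfl
/-- `loop2_rD` (auxiliary). [folklore] -/
theorem loop2_rD : (P.loop2 he).rD = P.rD := rfl
/-- `loop2_rDu` (auxiliary). [folklore] -/
theorem loop2_rDu : (P.loop2 he).rDu = P.rDu := rfl
/-- `loop2_hg` (auxiliary). [folklore] -/
theorem loop2_hg : (P.loop2 he).hg = P.hD + P.zone := rfl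
/-- `loop2_hgu` (auxiliary). [folklore] -/
theorem loop2_hgu : (P.loop2 he).hgu = P.hDu - P.zone := rfl
/-- `loop2_lam` (auxiliary). [folklore] -/
theorem loop2_lam : (P.loop2 he).lam = P.lam := rfl
/-- `loop2_CT` (auxiliary). [folklore] -/
theorem loop2_CT : (P.loop2 he).CT = P.CT := rfl


/-! ### The axis height -/

/-- `ΘB_hD` (auxiliary). [folklore] -/
theorem ΘB_hD : c.ΘB P.hD = P.φ + P.θD := by rw [φ]; ring
/-- `ΘB_hDu` (auxiliary). [folklore] -/
theorem ΘB_hDu : c.ΘB P.hDu = P.φ - P.θDu := by rw [θDu, S, φ]; ring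

/-- `hD_lt_hDu` (auxiliary). [folklore] -/
theorem hD_lt_hDu : P.hD < P.hDu := by have := P.hD_mem'.2; have := P.hDu_mem'.1; linarith

/-- `exists_hA` (auxiliary). [folklore] -/
theorem exists_hA : ∃ h ∈ Icc P.hD P.hDu, c.ΘB h = P.φ := by
  have hsub : Icc P.hD P.hDu ⊆ Icc (10⁻¹ : ℝ) (9 / 10) := fun h hh ↦
    ⟨by linarith [hh.1, P.hD_mem'.1], by linarith [hh.2, P.hDu_mem'.2]⟩
  have hc : ContinuousOn c.ΘB (Icc P.hD P.hDu) := by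
    have : c.ΘB = fun y ↦ 2 * π * c.thetaB y := rfl
    rw [this]; exact (continuousOn_const.mul c.continuousOn_thetaB).mono hsub
  have hmem : P.φ ∈ Icc (c.ΘB P.hDu) (c.ΘB P.hD) := by
    rw [P.ΘB_hD, P.ΘB_hDu]; have := P.θD_mem.1; have := P.θDu_mem.1; have := c.θlow_pos
    exact ⟨by linarith, by linarith⟩
  obtain ⟨h, hh, hhφ⟩ := intermediate_value_Icc' P.hD_lt_hDu.le hc hmem
  exact ⟨h, hh, hhφ⟩

/-- **The axis height** `h_A`: `ΘB h_A = φ`. [folklore] -/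
def hA : ℝ := Classical.choose P.exists_hA

/-- `hA_mem` (auxiliary). [folklore] -/
theorem hA_mem : P.hA ∈ Icc P.hD P.hDu := (Classical.choose_spec P.exists_hA).1
/-- `ΘB_hA` (auxiliary). [folklore] -/
theorem ΘB_hA : c.ΘB P.hA = P.φ := (Classical.choose_spec P.exists_hA).2
/-- `hA_win` (auxiliary). [folklore] -/
theorem hA_win : P.hA ∈ Icc (0.12 : ℝ) 0.88 := ⟨by linarith [P.hA_mem.1, P.hD_mem'.1], by linarith [P.hA_mem.2, P.hDu_mem'.2]⟩

/-- The axis is at least `θ_low / MΘ` above the lower tip and below the upper tip. [folklore] -/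
theorem hA_sub_hD_ge : c.θlow / P.MΘ ≤ P.hA - P.hD := by
  have h := P.abs_ΘB_sub_le P.hD_win P.hA_win
  rw [P.ΘB_hD, P.ΘB_hA, abs_of_nonpos (by linarith [P.hA_mem.1] : P.hD - P.hA ≤ 0)] at h
  have hθ := P.θD_mem.1; have hM := P.MΘ_pos
  rw [div_le_iff₀ hM]
  have : |P.φ + P.θD - P.φ| = P.θD := by rw [add_sub_cancel_left, abs_of_pos (c.θlow_pos.trans_le hθ)]
  rw [this] at h; nlinarith

/-- `hDu_sub_hA_ge` (auxiliary). [folklore] -/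
theorem hDu_sub_hA_ge : c.θlow / P.MΘ ≤ P.hDu - P.hA := by
  have h := P.abs_ΘB_sub_le P.hA_win P.hDu_win
  rw [P.ΘB_hDu, P.ΘB_hA, abs_of_nonpos (by linarith [P.hA_mem.2] : P.hA - P.hDu ≤ 0)] at h
  have hθ := P.θDu_mem.1; have hM := P.MΘ_pos
  rw [div_le_iff₀ hM]
  have : |P.φ - (P.φ - P.θDu)| = P.θDu := by rw [sub_sub_cancel, abs_of_pos (c.θlow_pos.trans_le hθ)]
  rw [this] at h; nlinarith

/-- `zone_le_half` (auxiliary). [folklore] -/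
theorem zone_le_half : P.zone ≤ c.θlow / (2 * P.MΘ) := by
  have h := P.MΘ_zone_le; have hM := P.MΘ_pos
  rw [le_div_iff₀ (by linarith)]; nlinarith

/-- `κD_emax_div_lam_le` (auxiliary). [folklore] -/
theorem κD_emax_div_lam_le : P.κD * P.emax / P.lam ≤ c.θlow / (2 * P.MΘ) := by
  have h := P.fingerB; have hl := P.lam_pos; have hM := P.MΘ_pos
  rw [div_le_div_iff₀ hl (by linarith)]; nlinarith

/-- `half_lt_full` (auxiliary). [folklore] -/
theorem half_lt_full : c.θlow / (2 * P.MΘ) < c.θlow / P.MΘ := by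
  have hM := P.MΘ_pos; have hθ := c.θlow_pos
  rw [div_lt_div_iff₀ (by linarith) hM]; nlinarith

/-! ### Bounds through `|tw| ≤ cmax` for the fingertip -/

/-- `cos_half_ge` (auxiliary). [folklore] -/
theorem cos_half_ge {θ : ℝ} (hθ : θ ∈ Icc c.θlow (π - c.θlow)) : sin (c.θlow / 2) ≤ cos (θ / 2) := by
  rw [← cos_pi_div_two_sub]
  apply cos_le_cos_of_nonneg_of_le_pi
  · linarith [hθ.1, c.θlow_pos]
  · linarith [c.θlow_pos, pi_pos]
  · linarith [hθ.2]

/-- `qF_le` (auxiliary). [folklore] -/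
theorem qF_le {θ : ℝ} (hθ : θ ∈ Icc c.θlow (π - c.θlow)) : exp (|P.tw| * 2) / cos (θ / 2) ^ 2 ≤ c.QF := by
  rw [QF]
  have hs := c.sin_θlow_half_pos
  have hc := cos_half_ge hθ
  calc exp (|P.tw| * 2) / cos (θ / 2) ^ 2 ≤ exp (|P.tw| * 2) / sin (c.θlow / 2) ^ 2 := by
        apply div_le_div_of_nonneg_left (exp_pos _).le (pow_pos hs 2)
        exact pow_le_pow_left₀ hs.le hc 2
    _ ≤ exp (c.cmax * 2) / sin (c.θlow / 2) ^ 2 :=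
        div_le_div_of_nonneg_right (exp_le_exp.2 (by nlinarith [P.abs_tw_le])) (pow_pos hs 2).le

/-- The fingertip band width with the actual twist is dominated by the band-level one. [folklore] -/
theorem finger_s_le {θ r : ℝ} (hθ : θ ∈ Icc c.θlow (π - c.θlow)) (hr : r - 1 ≤ P.κD * P.emax) (hr1 : 1 ≤ r) :
    |P.tw| * (r - 1) + exp (|P.tw| * 2) / cos (θ / 2) ^ 2 * P.MΘ * P.zone ≤
      c.cmax * P.κD * P.emax + c.QF * P.MΘ * (P.κD * P.emin / (4 * (P.Mρ * P.emax + P.Me)) + 2 * c.cmax * P.κD * P.emax / (c.qminc * P.mΘ)) := by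
  rw [← zone_eq]
  refine add_le_add ?_ ?_
  · calc |P.tw| * (r - 1) ≤ c.cmax * (r - 1) := mul_le_mul_of_nonneg_right P.abs_tw_le (by linarith)
      _ ≤ c.cmax * (P.κD * P.emax) := mul_le_mul_of_nonneg_left hr c.cmax_nonneg
      _ = c.cmax * P.κD * P.emax := by ring
  · exact mul_le_mul_of_nonneg_right (mul_le_mul_of_nonneg_right (P.qF_le hθ) P.MΘ_pos.le) P.zone_pos.le

/-- `finger_s_nonneg` (auxiliary). [folklore] -/
theorem finger_s_nonneg {θ r : ℝ} (hr1 : 1 ≤ r) :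
    0 ≤ |P.tw| * (r - 1) + exp (|P.tw| * 2) / cos (θ / 2) ^ 2 * P.MΘ * P.zone :=
  add_nonneg (mul_nonneg (abs_nonneg _) (by linarith))
    (mul_nonneg (mul_nonneg (div_nonneg (exp_pos _).le (sq_nonneg _)) P.MΘ_pos.le) P.zone_pos.le)

/-- `condF3_of` (auxiliary). [folklore] -/
theorem condF3_of {r : ℝ} (hr : r - 1 ≤ P.κD * P.emax) (hr1 : 1 ≤ r) :
    |P.tw| * (r - 1) < exp (-(|P.tw| * 2)) * P.mΘ * P.zone := by
  have h1 : |P.tw| * (r - 1) ≤ c.cmax * P.κD * P.emax := by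
    calc |P.tw| * (r - 1) ≤ c.cmax * (r - 1) := mul_le_mul_of_nonneg_right P.abs_tw_le (by linarith)
      _ ≤ c.cmax * (P.κD * P.emax) := mul_le_mul_of_nonneg_left hr c.cmax_nonneg
      _ = c.cmax * P.κD * P.emax := by ring
  have hq := P.qmin_ge
  have hz : c.qminc * P.mΘ * P.zone = c.qminc * P.mΘ * P.βc + 2 * (c.cmax * P.κD * P.emax) := by
    have hm : c.qminc * P.mΘ * (c.cmax * P.κD * P.emax / (c.qminc * P.mΘ)) = c.cmax * P.κD * P.emax :=
      mul_div_cancel₀ _ (mul_pos c.qminc_pos P.mΘ_pos).ne'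
    rw [zone, Δhc]; linear_combination 2 * hm
  have hpos : 0 < c.qminc * P.mΘ * P.βc := mul_pos (mul_pos c.qminc_pos P.mΘ_pos) P.βc_pos
  have h2 : c.qminc * P.mΘ * P.zone ≤ exp (-(|P.tw| * 2)) * P.mΘ * P.zone :=
    mul_le_mul_of_nonneg_right (mul_le_mul_of_nonneg_right hq P.mΘ_pos.le) P.zone_pos.le
  nlinarith [c.cmax_nonneg, P.κD_pos, P.emax_pos]

/-- `condF4_of` (auxiliary). [folklore] -/
theorem condF4_of : (1 + P.CT) * P.lam * |P.tw| < exp (-(|P.tw| * 2)) * P.mΘ := by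
  have h1 : (1 + P.CT) * P.lam * |P.tw| ≤ (1 + P.CT) * P.lam * c.cmax :=
    mul_le_mul_of_nonneg_left P.abs_tw_le (mul_nonneg (by linarith [P.CT_nonneg]) P.lam_pos.le)
  have h2 := P.lam_gentle
  have h3 := P.qmin_ge
  have hpos : 0 < (1 + P.CT) * P.lam := mul_pos (by linarith [P.CT_nonneg]) P.lam_pos
  have h4 : c.qminc * P.mΘ ≤ exp (-(|P.tw| * 2)) * P.mΘ := mul_le_mul_of_nonneg_right h3 P.mΘ_pos.le
  nlinarith [mul_pos c.qminc_pos P.mΘ_pos]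

/-! ### The two fingertip records -/

/-- `Θlo_hDval` (auxiliary). [folklore] -/
theorem Θlo_hDval : P.Θlo P.hD = P.θD := P.Θlo_hD
/-- `Θlo_hDu_val` (auxiliary). [folklore] -/
theorem Θlo_hDu_val : P.Θlo P.hDu = -P.θDu := by rw [Θlo, P.ΘB_hDu]; ring

/-- **The lower fingertip record.** [cite: Kirby1989, Ch. I §4] -/
def fingerLo : (P.loop2 he).FingerAngleData where
  Θ := P.Θlo
  c := P.tw
  hA := P.hA
  mΘ := P.mΘ
  MΘ := P.MΘ
  Θ_smooth := (contDiffOn_ΘB c).sub contDiffOn_const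
  hgA := by
    show P.hD + P.zone ≤ P.hA
    linarith [P.zone_le_half, P.half_lt_full, P.hA_sub_hD_ge]
  hA_le := by
    show P.hA ≤ P.hDu - (1 + P.du.κD * e P.hDu - (P.Mρ * P.emax + P.Me) * P.βc - (1 + P.κD * P.emin / 4)) / P.lam
    rw [du_κD]
    have h1 : (P.Mρ * P.emax + P.Me) * P.βc = P.κD * P.emin / 4 := P.smaxc_mul_βc
    have e2 := (P.e_bounds _ P.hDu_win).2
    have hb : (1 + P.κD * e P.hDu - P.κD * P.emin / 4 - (1 + P.κD * P.emin / 4)) / P.lam ≤ P.κD * P.emax / P.lam :=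
      div_le_div_of_nonneg_right (by nlinarith [P.κD_pos, P.emin_pos]) P.lam_pos.le
    rw [h1]; linarith [P.κD_emax_div_lam_le, P.half_lt_full, P.hDu_sub_hA_ge]
  hA_win := by linarith [P.hA_mem.2, P.hDu_mem'.2]
  Θ_hA := by show c.ΘB P.hA - P.φ = 0; rw [P.ΘB_hA]; ring
  ΘD_lt := by show P.Θlo P.hD < π; rw [P.Θlo_hD]; linarith [P.θD_mem.2, c.θlow_pos]
  mΘ_pos := P.mΘ_pos
  Θ_deriv := fun h hh ↦ by
    have hd : deriv P.Θlo h = deriv c.ΘB h := by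
      have : P.Θlo = fun y ↦ c.ΘB y - P.φ := rfl
      rw [this, deriv_sub_const]
    rw [hd]
    have h1 : P.hD ≤ h := hh.1
    exact P.Θ_deriv h ⟨by linarith [P.hD_mem'.1], by linarith [hh.2, P.hA_mem.2, P.hDu_mem'.2]⟩
  rD_le := P.rD_mem.2
  tip := by show exp (P.tw * P.rD) * tan (P.Θlo P.hD / 2) = 1; rw [P.Θlo_hD]; exact P.tip_lo
  condF1 := by
    show |P.tw| * (P.rD - 1) + exp (|P.tw| * 2) / cos (P.Θlo P.hD / 2) ^ 2 * P.MΘ * (P.hD + P.zone - P.hD) ≤ 2⁻¹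
    rw [P.Θlo_hD, add_sub_cancel_left]
    exact (P.finger_s_le P.θD_mem (by rw [rD]; nlinarith [(P.e_bounds _ P.hD_win).2, P.κD_pos]) P.rD_mem.1).trans P.condF1c
  condF1' := by
    show 8 * |P.tw| * (|P.tw| * (P.rD - 1) + exp (|P.tw| * 2) / cos (P.Θlo P.hD / 2) ^ 2 * P.MΘ * (P.hD + P.zone - P.hD)) ≤ 1
    rw [P.Θlo_hD, add_sub_cancel_left]
    have hs := P.finger_s_le P.θD_mem (by rw [rD]; nlinarith [(P.e_bounds _ P.hD_win).2, P.κD_pos]) P.rD_mem.1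
    have h0 := P.finger_s_nonneg (θ := P.θD) P.rD_mem.1
    have hc := P.abs_tw_le
    have := P.condF1c'
    nlinarith [abs_nonneg P.tw, c.cmax_nonneg, mul_le_mul hc hs h0 c.cmax_nonneg]
  condF2 := by
    show 16 * (exp (|P.tw| * 2) / cos (P.Θlo P.hD / 2) ^ 2 * P.MΘ) *
      (|P.tw| * (P.rD - 1) + exp (|P.tw| * 2) / cos (P.Θlo P.hD / 2) ^ 2 * P.MΘ * (P.hD + P.zone - P.hD)) < P.lam
    rw [P.Θlo_hD, add_sub_cancel_left]
    have hs := P.finger_s_le P.θD_mem (by rw [rD]; nlinarith [(P.e_bounds _ P.hD_win).2, P.κD_pos]) P.rD_mem.1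
    have h0 := P.finger_s_nonneg (θ := P.θD) P.rD_mem.1
    have hq := mul_le_mul_of_nonneg_right (P.qF_le P.θD_mem) P.MΘ_pos.le
    have hq0 : 0 ≤ exp (|P.tw| * 2) / cos (P.θD / 2) ^ 2 * P.MΘ := mul_nonneg (div_nonneg (exp_pos _).le (sq_nonneg _)) P.MΘ_pos.le
    have := P.condF2c
    nlinarith [mul_le_mul hq hs h0 (hq0.trans hq)]
  condF3 := by
    show |P.tw| * (P.rD - 1) < exp (-(|P.tw| * 2)) * P.mΘ * (P.hD + P.zone - P.hD)
    rw [add_sub_cancel_left]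
    exact P.condF3_of (by rw [rD]; nlinarith [(P.e_bounds _ P.hD_win).2, P.κD_pos]) P.rD_mem.1
  condF4 := P.condF4_of

/-- **The upper fingertip record.** [cite: Kirby1989, Ch. I §4] -/
theorem fingerUp : K1Loop2Data.FingerAngleDataUp (P.fingerLo he) where
  hA_ge := by
    show P.hD + (1 + P.dl.κD * e P.hD - (P.Mρ * P.emax + P.Me) * P.βc - (1 + P.κD * P.emin / 4)) / P.lam ≤ P.hA
    rw [dl_κD]
    have h1 : (P.Mρ * P.emax + P.Me) * P.βc = P.κD * P.emin / 4 := P.smaxc_mul_βc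
    have e2 := (P.e_bounds _ P.hD_win).2
    have hb : (1 + P.κD * e P.hD - P.κD * P.emin / 4 - (1 + P.κD * P.emin / 4)) / P.lam ≤ P.κD * P.emax / P.lam :=
      div_le_div_of_nonneg_right (by nlinarith [P.κD_pos, P.emin_pos]) P.lam_pos.le
    rw [h1]; linarith [P.κD_emax_div_lam_le, P.half_lt_full, P.hA_sub_hD_ge]
  hA_le_hgu := by
    show P.hA ≤ P.hDu - P.zone
    linarith [P.zone_le_half, P.half_lt_full, P.hDu_sub_hA_ge]
  ΘDu_lt := by show -P.Θlo P.hDu < π; rw [P.Θlo_hDu_val, neg_neg]; linarith [P.θDu_mem.2, c.θlow_pos]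
  Θ_deriv_up := fun h hh ↦ by
    have hd : deriv P.Θlo h = deriv c.ΘB h := by
      have : P.Θlo = fun y ↦ c.ΘB y - P.φ := rfl
      rw [this, deriv_sub_const]
    show -P.MΘ ≤ deriv P.Θlo h ∧ deriv P.Θlo h ≤ -P.mΘ
    rw [hd]
    have h1 : P.hA ≤ h := hh.1
    have h2 : h ≤ P.hDu := hh.2
    exact P.Θ_deriv h ⟨by linarith [P.hA_mem.1, P.hD_mem'.1], by linarith [P.hDu_mem'.2]⟩
  rDu_le := P.rDu_mem.2
  tip_up := by
    show exp (P.tw * P.rDu) * tan (-P.Θlo P.hDu / 2) = 1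
    rw [P.Θlo_hDu_val, neg_neg]; exact P.tip_up
  condF1u := by
    show |P.tw| * (P.rDu - 1) + exp (|P.tw| * 2) / cos (-P.Θlo P.hDu / 2) ^ 2 * P.MΘ * (P.hDu - (P.hDu - P.zone)) ≤ 2⁻¹
    rw [P.Θlo_hDu_val, neg_neg, sub_sub_cancel]
    exact (P.finger_s_le P.θDu_mem (by rw [rDu]; nlinarith [(P.e_bounds _ P.hDu_win).2, P.κD_pos]) P.rDu_mem.1).trans P.condF1c
  condF1u' := by
    show 8 * |P.tw| * (|P.tw| * (P.rDu - 1) + exp (|P.tw| * 2) / cos (-P.Θlo P.hDu / 2) ^ 2 * P.MΘ * (P.hDu - (P.hDu - P.zone))) ≤ 1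
    rw [P.Θlo_hDu_val, neg_neg, sub_sub_cancel]
    have hs := P.finger_s_le P.θDu_mem (by rw [rDu]; nlinarith [(P.e_bounds _ P.hDu_win).2, P.κD_pos]) P.rDu_mem.1
    have h0 := P.finger_s_nonneg (θ := P.θDu) P.rDu_mem.1
    have hc := P.abs_tw_le
    have := P.condF1c'
    nlinarith [abs_nonneg P.tw, c.cmax_nonneg, mul_le_mul hc hs h0 c.cmax_nonneg]
  condF2u := by
    show 16 * (exp (|P.tw| * 2) / cos (-P.Θlo P.hDu / 2) ^ 2 * P.MΘ) *
      (|P.tw| * (P.rDu - 1) + exp (|P.tw| * 2) / cos (-P.Θlo P.hDu / 2) ^ 2 * P.MΘ * (P.hDu - (P.hDu - P.zone))) < P.lam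
    rw [P.Θlo_hDu_val, neg_neg, sub_sub_cancel]
    have hs := P.finger_s_le P.θDu_mem (by rw [rDu]; nlinarith [(P.e_bounds _ P.hDu_win).2, P.κD_pos]) P.rDu_mem.1
    have h0 := P.finger_s_nonneg (θ := P.θDu) P.rDu_mem.1
    have hq := mul_le_mul_of_nonneg_right (P.qF_le P.θDu_mem) P.MΘ_pos.le
    have hq0 : 0 ≤ exp (|P.tw| * 2) / cos (P.θDu / 2) ^ 2 * P.MΘ := mul_nonneg (div_nonneg (exp_pos _).le (sq_nonneg _)) P.MΘ_pos.le
    have := P.condF2c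
    nlinarith [mul_le_mul hq hs h0 (hq0.trans hq)]
  condF3u := by
    show |P.tw| * (P.rDu - 1) < exp (-(|P.tw| * 2)) * P.mΘ * (P.hDu - (P.hDu - P.zone))
    rw [sub_sub_cancel]
    exact P.condF3_of (by rw [rDu]; nlinarith [(P.e_bounds _ P.hDu_win).2, P.κD_pos]) P.rDu_mem.1
  condF4u := P.condF4_of

end SlideChoice

end BandCore

end Literature.Topology.FourManifolds
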